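import Mathlib
import HarnessLib
import Summits.NavierStokesRegularity.NavierStokesRegularity.Theses.EulerZoomLiouville
import Summits.NavierStokesRegularity.NavierStokesRegularity.Theorems.EulerZoomLiouvilleSereginZoomReduction
import Summits.NavierStokesRegularity.NavierStokesRegularity.Theorems.EulerZoomLiouvilleResidualCalibration

/-!
# Route `EulerZoomLiouville` (№10): the state of the route BY NAME with the support item Z PROVED

Helper file (theorems only). Seat ns-typeII-p3 (cell ns-regularity-ideate §B, D-0081). Pure composition of tree
theorems; no analysis.  Sequel of `EulerZoomLiouvilleStateOfRoute.lean`, where Z (`SereginZoomReduction`, Seregin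
arXiv:2606.29468 Thm 3.1 at the power weight) entered as the HYPOTHESIS of a printed fact: Z is now the kernel theorem
`SereginZoomReduction.sereginZoomReduction_proof` (stmt-NavierStokesRegularity-19834 closed·proved), and the
assembly `EulerZoomLiouville.closes` needs only the three OPEN conjuncts — the crux E (`PowerGaugeEulerLiouville`, the
Chae–Shvydkoy-window Euler Liouville theorem) and the declared residuals R₁ (`TypeIOrPowerZoomable`) and (L)
(`TypeIliouvilleL`, KNSS):

* `navierStokesRegularity_of_cruxes : E → R₁ → (L) → NavierStokesRegularity`;
* `noTypeII_of_cruxes : E → R₁ → TypeILiouville.TypeIliouvilleNoTypeII` (the §B hard core stmt-0056, no (L)).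

These two lines ARE the route's kernel-checked distance to the summit / to N0 after Z.  WHAT THIS IS NOT: not NS and
not progress on E, R₁ or (L) — bookkeeping. [folklore]
-/

noncomputable section

-- the summit and its single sub-problem share the name (CONVENTIONS §1), as in every Theorems file
set_option linter.dupNamespace false

namespace Summit.NavierStokesRegularity.NavierStokesRegularity.Theorems.EulerZoomLiouvilleStateOfRoute

open Summit.NavierStokesRegularity.NavierStokesRegularity.Theses
open Summit.NavierStokesRegularity.NavierStokesRegularity.Theorems

/-- **Clay (A) from E + R₁ + (L)** (route №10 with its support conjunct Z proved in the kernel). [folklore] -/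
theorem navierStokesRegularity_of_cruxes
    (hE : EulerZoomLiouville.PowerGaugeEulerLiouville) (hR : EulerZoomLiouville.TypeIOrPowerZoomable)
    (hL : EulerZoomLiouville.TypeIliouvilleL) : _root_.NavierStokesRegularity :=
  EulerZoomLiouville.closes hE SereginZoomReduction.sereginZoomReduction_proof hR hL

/-- **The hard core stmt-0056 (every first blow-up is Type I) from E + R₁** — no Liouville conjecture (L) and no
printed fact needed any more. [folklore] -/
theorem noTypeII_of_cruxes
    (hE : EulerZoomLiouville.PowerGaugeEulerLiouville) (hR : EulerZoomLiouville.TypeIOrPowerZoomable) :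
    TypeILiouville.TypeIliouvilleNoTypeII :=
  EulerZoomLiouvilleResidualCalibration.noTypeII_of_conjuncts hE SereginZoomReduction.sereginZoomReduction_proof hR

end Summit.NavierStokesRegularity.NavierStokesRegularity.Theorems.EulerZoomLiouvilleStateOfRoute

end
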